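import Summits.QuantumFields.YangMills.Theorems.ParabolicTrajectoryLatticeGapOnTrajectorySlabClusteringTorusKernels
import Summits.QuantumFields.YangMills.Theorems.ParabolicTrajectoryLatticeGapOnTrajectoryStubKRFiniteSizeDecay
import HarnessLib

/-!
# Crux `LatticeGapOnTrajectory` (stmt-QuantumFields-10523), line `sparse-defect-orbit-window`:
# stub (R) `stub_torusRange` — finite range one cell of Wilson's torus specification on frame windows

Registered stub (R) of the line skeleton, `--supports stmt-QuantumFields-10523` (G-blind plumbing;
nothing about mass gaps is asserted, everything here is proved).

For axis frames `q i : ℤ/(2S+1) → ℤ/(μ i + 1)` (any scale), a window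
`W(c) = windowVol (cellOf q) n c = {e | cdist c (cellOf q e) ≤ n}` and a boundary cell `y` with
`cdist c y > n + 1`, two boundary data agreeing off `y` give the same window expectation
`γ_{W(c)} f` of every bounded measurable `f` reading only `W(c)`, `γ = torusYM r.ρ β (2S+1)`.

Proof. One lattice step along an axis moves a frame label by `0` or `±1` on that axis and fixes the
other coordinates (`IsTorusFrame`), so lattice neighbours (every coordinate equal or one step apart)
have cell labels at coarse (`ℓ^∞` cyclic) distance `≤ 1` (`cdist_siteCell_le_one`). Every site of the
shadow of `W(c)` (base points of the links of `W(c)` and their backward translates) and all its forward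
neighbours therefore carry labels within `n + 1` of `c` (`cdist_le_of_mem_edgeShadow`,
`cdist_triangle`), i.e. every plaquette based in the shadow has its four links in
`T = {e | cdist c (cellOf q e) ≤ n + 1}`; the finite-range lemma
`SlabClustering.dependsOn_windowAvg_torusYM` (TorusKernels) gives `DependsOn (γ_{W(c)} f) T`, and
the two boundary data agree on `T` since `T` misses the cell `y`.
-/

set_option autoImplicit false

noncomputable section

namespace Summit.QuantumFields.YangMills.Cruxes.LatticeGapOnTrajectory.SparseDefectOrbitWindow

open Filter MeasureTheory
open Literature.Probability.LatticeModels (Specification IsSpecification IsGibbsMeasure glueWith)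
open Literature.MathematicalPhysics.QuantumFieldTheory
open Summit.QuantumFields.YangMills.Cruxes.LatticeGapOnTrajectory.OrbitKantorovichFiniteSize

namespace StubTorusRange

/-! ### One lattice step moves a frame label by at most one -/

/-- The cyclic representative of `1` has absolute value at most `1` (also on `ℤ/1` and `ℤ/2`). -/
theorem natAbs_valMinAbs_one_le (m : ℕ) [NeZero m] : ((1 : ZMod m).valMinAbs).natAbs ≤ 1 := by
  have h : ((((1 : ℤ) : ZMod m)).valMinAbs).natAbs ≤ (1 : ℤ).natAbs :=
    ZMod.natAbs_min_of_le_div_two m _ _ (ZMod.coe_valMinAbs _) (ZMod.natAbs_valMinAbs_le _)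
  simpa using h

/-- A frame steps by `0` or `1`: the labels of `z` and `z + 1` are at cyclic distance `≤ 1`. -/
theorem natAbs_valMinAbs_frame_step_le {N m b : ℕ} [NeZero m] {q : ZMod N → ZMod m}
    (hq : IsTorusFrame N b q) (z : ZMod N) : ((q (z + 1) - q z).valMinAbs).natAbs ≤ 1 := by
  rcases hq.1 z with h | h
  · rw [h, sub_self, ZMod.valMinAbs_zero]
    exact Nat.zero_le _
  · rw [h, add_sub_cancel_left]
    exact natAbs_valMinAbs_one_le m

variable {N : ℕ} {μ : Fin 4 → ℕ} {b : ℕ} {q : (i : Fin 4) → ZMod N → ZMod (μ i + 1)}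

/-- **Lattice neighbours have neighbouring labels.** If every coordinate of `x'` equals the
corresponding coordinate of `x` or is one step away from it, the cell labels of `x` and `x'` are at
coarse distance `≤ 1`. -/
theorem cdist_siteCell_le_one (hq : ∀ i, IsTorusFrame N b (q i)) {x x' : Site 4 N}
    (h : ∀ k, x' k = x k ∨ x' k = x k + 1 ∨ x' k + 1 = x k) :
    cdist (siteCell q x) (siteCell q x') ≤ 1 := by
  unfold cdist
  refine Finset.sup_le fun k _ => ?_
  show ((q k (x k) - q k (x' k)).valMinAbs).natAbs ≤ 1
  rcases h k with hk | hk | hk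
  · rw [hk, sub_self, ZMod.valMinAbs_zero]
    exact Nat.zero_le _
  · rw [hk, ← ZMod.natAbs_valMinAbs_neg, neg_sub]
    exact natAbs_valMinAbs_frame_step_le (hq k) (x k)
  · rw [← hk]
    exact natAbs_valMinAbs_frame_step_le (hq k) (x' k)

/-- A forward unit step `x ↦ x + e_i` moves the cell label by at most one. -/
theorem cdist_siteCell_shift_le_one (hq : ∀ i, IsTorusFrame N b (q i)) (x : Site 4 N) (i : Fin 4) :
    cdist (siteCell q x) (siteCell q (x.shift i)) ≤ 1 := by
  refine cdist_siteCell_le_one hq fun k => ?_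
  rw [Site.shift]
  by_cases hk : k = i
  · subst hk
    exact Or.inr (Or.inl (by simp))
  · exact Or.inl (by simp [Pi.single_eq_of_ne hk])

/-- A backward unit step `z ↦ z - e_m` moves the cell label by at most one. -/
theorem cdist_siteCell_sub_single_le_one (hq : ∀ i, IsTorusFrame N b (q i)) (z : Site 4 N)
    (m : Fin 4) : cdist (siteCell q z) (siteCell q (z - Pi.single m 1)) ≤ 1 := by
  refine cdist_siteCell_le_one hq fun k => ?_
  by_cases hk : k = m
  · subst hk
    exact Or.inr (Or.inr (by simp))
  · exact Or.inl (by simp [Pi.single_eq_of_ne hk])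

/-- A backward step followed by a forward step, `z ↦ z - e_m + e_i`, moves the cell label by at
most one (on axis `m` by `-1`, on axis `i` by `+1`, or not at all when `i = m`). -/
theorem cdist_siteCell_sub_single_shift_le_one (hq : ∀ i, IsTorusFrame N b (q i)) (z : Site 4 N)
    (m i : Fin 4) : cdist (siteCell q z) (siteCell q ((z - Pi.single m 1).shift i)) ≤ 1 := by
  refine cdist_siteCell_le_one hq fun k => ?_
  rw [Site.shift]
  by_cases hkm : k = m
  · subst hkm
    by_cases hki : k = i
    · subst hki
      exact Or.inl (by simp)
    · exact Or.inr (Or.inr (by simp [Pi.single_eq_of_ne hki]))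
  · by_cases hki : k = i
    · subst hki
      exact Or.inr (Or.inl (by simp [Pi.single_eq_of_ne hkm]))
    · exact Or.inl (by simp [Pi.single_eq_of_ne hkm, Pi.single_eq_of_ne hki])

/-! ### The shadow of a frame window stays within one cell of the window -/

variable [NeZero N]

/-- **Shadow geometry of a frame window.** Every site of the shadow of the window
`W(c) = windowVol (cellOf q) n c` and each of its forward neighbours carries a cell label at coarse
distance `≤ n + 1` from the centre `c`. -/
theorem cdist_le_of_mem_edgeShadow (hq : ∀ i, IsTorusFrame N b (q i)) (n : ℕ) (c : CoarseIdx μ)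
    {x : Site 4 N} (hx : x ∈ edgeShadow (windowVol (cellOf q) n c)) :
    cdist c (siteCell q x) ≤ n + 1 ∧ ∀ i : Fin 4, cdist c (siteCell q (x.shift i)) ≤ n + 1 := by
  classical
  unfold edgeShadow at hx
  rcases Finset.mem_union.1 hx with h | h
  · obtain ⟨e, he, rfl⟩ := Finset.mem_image.1 h
    have hn : cdist c (siteCell q e.1) ≤ n := by
      have := (Finset.mem_filter.1 he).2
      simpa [cellOf] using this
    refine ⟨hn.trans (Nat.le_succ n), fun i => ?_⟩
    calc cdist c (siteCell q (e.1.shift i))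
        ≤ cdist c (siteCell q e.1) + cdist (siteCell q e.1) (siteCell q (e.1.shift i)) :=
          KRFiniteSize.cdist_triangle _ _ _
      _ ≤ n + 1 := add_le_add hn (cdist_siteCell_shift_le_one hq e.1 i)
  · obtain ⟨p, hp, rfl⟩ := Finset.mem_image.1 h
    obtain ⟨he, -⟩ := Finset.mem_product.1 hp
    have hn : cdist c (siteCell q p.1.1) ≤ n := by
      have := (Finset.mem_filter.1 he).2
      simpa [cellOf] using this
    refine ⟨?_, fun i => ?_⟩
    · -- the backward translate `p.1.1 - e_{p.2}` of a base point of the window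
      exact (KRFiniteSize.cdist_triangle c (siteCell q p.1.1) _).trans
        (add_le_add hn (cdist_siteCell_sub_single_le_one hq p.1.1 p.2))
    · -- and its forward neighbours `p.1.1 - e_{p.2} + e_i`
      exact (KRFiniteSize.cdist_triangle c (siteCell q p.1.1) _).trans
        (add_le_add hn (cdist_siteCell_sub_single_shift_le_one hq p.1.1 p.2 i))

/-- **Plaquettes touching a frame window.** Every plaquette based in the shadow of the window
`W(c)` of radius `n` has its four links in cells at coarse distance `≤ n + 1` from `c` (the
hypothesis of `SlabClustering.dependsOn_windowAvg_torusYM` with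
`T = {e | cdist c (cellOf q e) ≤ n + 1}`). -/
theorem plaquette_links_near (hq : ∀ i, IsTorusFrame N b (q i)) (n : ℕ) (c : CoarseIdx μ)
    (p : Plaquette 4 N) (hp : p.1 ∈ edgeShadow (windowVol (cellOf q) n c)) :
    cdist c (cellOf q (p.1, p.2.1.1)) ≤ n + 1 ∧
      cdist c (cellOf q (p.1.shift p.2.1.1, p.2.1.2)) ≤ n + 1 ∧
      cdist c (cellOf q (p.1.shift p.2.1.2, p.2.1.1)) ≤ n + 1 ∧
      cdist c (cellOf q (p.1, p.2.1.2)) ≤ n + 1 := by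
  obtain ⟨h0, hs⟩ := cdist_le_of_mem_edgeShadow hq n c hp
  exact ⟨h0, hs _, hs _, h0⟩

end StubTorusRange

/-- **Stub (R) `stub_torusRange`** (G-blind): FINITE RANGE ONE CELL of Wilson's torus specification
on frame windows. For axis frames `q` (any scale), a window `W(c) = {e | cdist c (cellOf q e) ≤ n}` and a
boundary cell `y` with `cdist c y > n + 1`, two boundary data agreeing off `y` give the same window
expectation of every bounded measurable `f` reading only `W(c)`: every plaquette meeting the shadow of
`W(c)` has its four links in cells at coarse distance `≤ n + 1` from `c` (one lattice step moves a frame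
label by at most one, `IsTorusFrame`), so `SlabClustering.dependsOn_windowAvg_torusYM` applies with
`T = {e | cdist c (cellOf q e) ≤ n + 1}`, and the two boundary data agree on `T`. Field `range` of
`IsTypicalKRWindow` / `IsKRWindow`. -/
theorem stub_torusRange :
    ∀ (G : Type) [Group G] [TopologicalSpace G] [IsTopologicalGroup G] [CompactSpace G]
      [MeasurableSpace G] [BorelSpace G] (r : LatticeRep G) (β : ℝ) {S : ℕ} {μ : Fin 4 → ℕ}
      (q : (i : Fin 4) → ZMod (2 * S + 1) → ZMod (μ i + 1)) {b : ℕ},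
      (∀ i, IsTorusFrame (2 * S + 1) b (q i)) →
      ∀ (n : ℕ) (c y : CoarseIdx μ), n + 1 < cdist c y →
        ∀ (ω η : GaugeConfig 4 (2 * S + 1) G), (∀ e, cellOf q e ≠ y → ω e = η e) →
        ∀ f : GaugeConfig 4 (2 * S + 1) G → ℝ, Measurable f → (∃ B, ∀ U, |f U| ≤ B) →
          DependsOn f {e | cdist c (cellOf q e) ≤ n} →
            windowAvg (torusYM r.ρ β (2 * S + 1)) (windowVol (cellOf q) n c) f ω =
              windowAvg (torusYM r.ρ β (2 * S + 1)) (windowVol (cellOf q) n c) f η := by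
  intro G _ _ _ _ _ _ r β S μ q b hq n c y hcy ω η hωη f hf _ hdep
  classical
  -- `f` reads only the links of the window
  have hfdep' : DependsOn f (↑(windowVol (cellOf q) n c) : Set (Edge 4 (2 * S + 1))) := by
    intro U V hUV
    refine hdep fun e he => hUV e ?_
    rw [Finset.mem_coe, windowVol, Finset.mem_filter]
    exact ⟨Finset.mem_univ _, he⟩
  -- every plaquette based in the shadow of the window has its links within `n + 1` cells of `c`
  have hT : ∀ p : Plaquette 4 (2 * S + 1), p.1 ∈ edgeShadow (windowVol (cellOf q) n c) →
      ((p.1, p.2.1.1) ∈ windowVol (cellOf q) n c ∨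
          (p.1, p.2.1.1) ∈ {e : Edge 4 (2 * S + 1) | cdist c (cellOf q e) ≤ n + 1}) ∧
        ((p.1.shift p.2.1.1, p.2.1.2) ∈ windowVol (cellOf q) n c ∨
          (p.1.shift p.2.1.1, p.2.1.2) ∈ {e : Edge 4 (2 * S + 1) | cdist c (cellOf q e) ≤ n + 1}) ∧
        ((p.1.shift p.2.1.2, p.2.1.1) ∈ windowVol (cellOf q) n c ∨
          (p.1.shift p.2.1.2, p.2.1.1) ∈ {e : Edge 4 (2 * S + 1) | cdist c (cellOf q e) ≤ n + 1}) ∧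
        ((p.1, p.2.1.2) ∈ windowVol (cellOf q) n c ∨
          (p.1, p.2.1.2) ∈ {e : Edge 4 (2 * S + 1) | cdist c (cellOf q e) ≤ n + 1}) := by
    intro p hp
    obtain ⟨h1, h2, h3, h4⟩ := StubTorusRange.plaquette_links_near hq n c p hp
    exact ⟨Or.inr h1, Or.inr h2, Or.inr h3, Or.inr h4⟩
  -- finite range of the torus kernels, and the two boundary data agree on `T`
  refine SlabClustering.dependsOn_windowAvg_torusYM r β (windowVol (cellOf q) n c)
    (T := {e : Edge 4 (2 * S + 1) | cdist c (cellOf q e) ≤ n + 1}) hT hf hfdep' fun e he => ?_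
  refine hωη e fun hey => ?_
  have he' : cdist c (cellOf q e) ≤ n + 1 := he
  rw [hey] at he'
  exact absurd hcy (not_lt.2 he')

end Summit.QuantumFields.YangMills.Cruxes.LatticeGapOnTrajectory.SparseDefectOrbitWindow

end
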